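import Summits.BirchSwinnertonDyer.BirchSwinnertonDyer.Theorems.ResidualThetaTransportAtTwoResidualSignedLambdaLowerCMAtTwoChildABClosedOfQuotientFact
import HarnessLib

/-!
# KZ_g (item stmt-BirchSwinnertonDyer-24105, `KatoZetaCMFormAtTwoSupply`) CLOSED MODULO TWO CITED LITERATURE FACTS:
# `Kato2004.thm12_4_newform → Kato2004.exists_zetaElement_newform_tatePairing_values_quotient_two → KatoZetaCMFormAtTwoSupply`

Route `ResidualThetaTransportAtTwo` (RTT); the HOLD item KZ_g stmt-BirchSwinnertonDyer-24105 (S3″ = K0a ∧ K0b ∧ body) is the print node of crux RSL_g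
(stmt-BirchSwinnertonDyer-22608, line onepair v3j) and of (R≥)ᵖ (stmt-BirchSwinnertonDyer-26074, line bt26_lambda v10). LEAD `bsd-wall-rtt-p2` g21
(`--supports 22608 --as helper`; closes no item). THEOREMS ONLY (no definition, no named fact, no instance, no `sorry`).

After the merged child-B port (`OnePair.ChildAB.childAB_of_quotientFact`, p740817; `ChildAB.stub_kzgChildAB_of_quotientFact`, p741505) and the ROAD-M
adapter (`ChildAB.katoZetaCMAtTwo_of_childAB`, p736564: K0a by the theorem `Kato2004.nonempty_iwasawaH1DataCoeff_newform_holds`, stations (E) p722652 /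
(DESC) p727151 / (R) p725106 through `KZgGlue.iHalf_of_stations` p719630), the route decl of item 24105 follows from exactly TWO Literature `def`s:
K0b `Kato2004.thm12_4_newform` (Kato Thm. 12.4 (1)(2) — a displayed CONJUNCT of the item's own text, so it cannot be dropped here) and the
Kato–Burungale–Tian quotient fact `Kato2004.exists_zetaElement_newform_tatePairing_values_quotient_two` (p736193). This file records that certificate
(the item's text and the registered S3″ stub text agree by `exact`, as in `KZgGlue.katoZetaCMFormAtTwoSupply_of_interior`).

HONEST FRAMING: a conditional result (both hypotheses are unproved named facts, XL); item 24105 stays HELD/OPEN until the gate says otherwise;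
BSD is not proved by any of this. References: [Kato2004Asterisque] Thm. 12.4, 12.5 (1)–(3) (pp. 221–222), §15.16; [BurungaleTian2026] Thm. 2.6.
-/

set_option autoImplicit false
-- the Theorems namespace of this sub repeats the summit name by design (D-0017 nested layout)
set_option linter.dupNamespace false

noncomputable section

namespace Summit.BirchSwinnertonDyer.BirchSwinnertonDyer.Theorems.OnePair.ChildAB

set_option maxHeartbeats 4000000 in
/-- **KZ_g (`KatoZetaCMFormAtTwoSupply`, item 24105) from K0b and the Kato–Burungale–Tian quotient fact** — `ChildAB.katoZetaCMAtTwo_of_childAB` fed with the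
merged port `ChildAB.stub_kzgChildAB_of_quotientFact`; K0a is a theorem, the stations and the glue are tree theorems. Conditional; BSD is not proved by this.
[cite: Kato2004Asterisque, Thm. 12.4 (1)(2), Thm. 12.5 (1)(2) (pp. 221–222), §15.16 (p. 265)] [cite: BurungaleTian2026, Thm. 2.6 (p. 5)] -/
theorem katoZetaCMFormAtTwoSupply_of_quotientFact
    (hK0b : Literature.NumberTheory.EllipticCurves.Kato2004.thm12_4_newform)
    (hq : Literature.NumberTheory.EllipticCurves.Kato2004.exists_zetaElement_newform_tatePairing_values_quotient_two) :
    Summit.BirchSwinnertonDyer.BirchSwinnertonDyer.Theses.ResidualThetaTransportAtTwo.KatoZetaCMFormAtTwoSupply :=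
  katoZetaCMAtTwo_of_childAB hK0b (stub_kzgChildAB_of_quotientFact hq)

end Summit.BirchSwinnertonDyer.BirchSwinnertonDyer.Theorems.OnePair.ChildAB

end
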